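import Literature.NumberTheory.EllipticCurves.CastellaGrossiLeeSkinner2022.RankOneTwistIdentity
import Literature.NumberTheory.EllipticCurves.HeegnerPoints
import Literature.NumberTheory.EllipticCurves.Tamagawa
import Literature.NumberTheory.EllipticCurves.Sha
import HarnessLib

/-!
# Castella–Grossi–Lee–Skinner 2022, proof of Thm. 5.3.1, display (5.5): the Heegner-index
# identity OVER `K` at a NON-ANOMALOUS Eisenstein prime of good reduction

HONEST FRAMING (cell `b2b-bsdres`, run/shared/lean/b2b/bsd-rank1-residual/; page 1 everywhere):
the goal of the cell is to DELETE the COMBINATION-SHAPED residual classes of the BSD formula for ALL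
analytic-rank `≤ 1` curves over `ℚ` from PUBLISHED theorems only, so that the remainder becomes
exactly the CONSTRUCTION-SHAPED classes, which are TYPED, not attempted; this is not "finishing
BSD". This file vendors ONE published statement as a named fact (`def … : Prop`, nothing asserted;
D-0014/D-0026) and PROVES its bookkeeping consumers. Unit `b2b-bsdres-lit-cgls` (off-peak
literature typer, source = Castella–Grossi–Lee–Skinner 2022 and Greenberg–Vatsal 2000), session 3.

## What and why

Session 2 of this seat typed display **(5.7)** of the proof of CGLS22 Thm. 5.3.1 — the identity OVER
`ℚ` between the BSD defects of `E` (rank `1`) and of its twist `E^K` (rank `0`)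
(`display57_rankOne_twist`, file `RankOneTwistIdentity.lean`). The printed proof reaches (5.7) by
"combining (5.5) and (5.6)": (5.6) is the Gross–Zagier formula rewritten, and **(5.5)** is the
identity OVER `K` that the ANTICYCLOTOMIC package delivers — Thm. 4.2.2 (the Iwasawa–Greenberg /
BDP main conjecture for `𝔛_E`), Thm. 5.1.1 (the anticyclotomic control theorem in the reducible
setting, after Jetchev–Skinner–Wan Thm. 3.3.1) and Thm. 5.1.3 (the Bertolini–Darmon–Prasanna
formula), together with (4.2) (`eq:comparison`) and (5.4) (`eq:thmA`):

> "`ord_p(#Ш(E/K)) = 2 · ord_p(c_E⁻¹ u_K⁻¹ · [E(K) : ℤ.P_K]) − Σ_{w ∈ S} ord_p(c_w(E/K))`"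

i.e. the `p`-part of the Gross–Zagier conjecture V.(2.2) / Gross 1991 (2.2) for `E/K`, WITH the
Manin constant `c_E` of the chosen parametrisation. This is one step closer to the main conjectures
than (5.7) (Gross–Zagier, the Artin formalism, the period relation and the descent of `Ш` from `K`
to `ℚ` are AFTER it in the proof), and it is stated in the currency the cell already uses for the
rank-one rows at a Heegner datum: the predicate `X11b.IndexIdentityAt W p K P`
(`2·ord_p ∏_ℓ c_ℓ(E/ℚ) + ord_p #Ш(E/K) = 2·ord_p [E(K) : ℤ·P]`, `Summits/…/X11b/BDPRoute.lean`) and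
its hypothesis form `X2.HeegnerIndexIdentity` (the TYPED missing input of the reducible
MULTIPLICATIVE rank-one sub-cell X2c, `Summits/…/X2/RankOneHeegner.lean`, whose docstring says: "At a
GOOD Eisenstein prime this is Castella–Grossi–Lee–Skinner 2022 Thm. 5.3.1 (anticyclotomic main
conjecture + control + BDP)"). This file makes that sentence a citation: the good-prime identity is
PRINTED as (5.5), and — for a datum with `p ∤ c_E` and an all-split `K` — it is LITERALLY the body
of `X11b.IndexIdentityAt` (`indexIdentity_of_display55`, below; the Summits-side adapters into
`X11b.IndexIdentityAt`, `X11b.bsdp_of_indexIdentityAt` and row C6 of the partition live in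
`Summits/BirchSwinnertonDyer/Rank1Residual/Partition/MainConjecturesEisensteinHeegner.lean`). The
anticyclotomic objects `𝔛_E`, `𝓛_E ∈ Λ^ur` themselves have no Literature definition today (SIZED
ASK S1 of the seat's deliverable HOME/b2b-bsdres-lit-cgls/CGLS-GV-TYPING.md), so the typable
published statement closest to those main conjectures is exactly this display.

## Citation header (read by this seat on the arXiv TeX source of v2 = the FINAL arXiv version,
## 2021-09-14, "Final version, to appear in Invent. Math" — the text of the version of record; arXiv
## lists v1 and v2 only, the label "v3" in the seat's session-2 docstrings is a slip for this v2 —,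
## `Eisenstein.tex` L2597–L2667, kept under HOME/b2b-bsdres-lit-cgls/src/cgls22-v2final/; and on the
## store's LaTeXML text of v1, `paper:arxiv-2008.02571` p0025 L60–L104 — identical at this display)

* Authors: Francesc Castella, Giada Grossi, Jaehoon Lee, Christopher Skinner.
* Title: *On the anticyclotomic Iwasawa theory of rational elliptic curves at Eisenstein primes*.
* Venue: Invent. Math. **227** (2022) 517–580, doi:10.1007/s00222-021-01072-y = arXiv:2008.02571v2
  (bib key `CastellaGrossiLeeSkinner2022`; older tree key `CastellaEtAl2021`). REFEREED / PUBLISHED.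
* Statement: **display (5.5)** (TeX label `eq:thmA-bis`, L2631–L2634) in the proof of
  **Theorem 5.3.1** (= Theorem F of the Introduction; §5.3 "Proof of the `p`-part of BSD formula").
* Hypotheses in force at (5.5), word for word (opening of Thm. 5.3.1 and of its proof, L2601–L2630):
  "Let `E/ℚ` be an elliptic curve, and let `p > 2` be a prime of good ordinary reduction for `E`.
  Assume that `E` admits a cyclic `p`-isogeny with kernel `C = 𝔽_p(φ)`, with `φ : G_ℚ → 𝔽_p^×`
  such that `φ|_{G_p} ≠ 1, ω` [the second bullet of Thm. 5.3.1, "`φ` is either ramified at `p` and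
  odd, or unramified at `p` and even", is used only in the last sentence of the proof, after (5.7),
  to apply Thm. 5.1.4 to `E^K`]. … Suppose `ord_{s=1} L(E,s) = 1` and choose … an imaginary
  quadratic field `K` of discriminant `D_K` such that (a) `D_K < -4` is odd, (b) every prime `ℓ`
  dividing `N` splits in `K`, (c) `p` splits in `K`, say `p = v v̄`, (d) `L(E^K,1) ≠ 0`. Then
  `ord_{s=1} L(E/K,s) = 1`, which by Theorem 5.1.2 implies that the Heegner point `P_K ∈ E(K)` has
  infinite order, and therefore `rank_ℤ E(K) = 1` and `#Ш(E/K) < ∞` by [Kolyvagin]. In particular,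
  (Sel) holds, and so all the hypotheses of Theorem 4.2.2 are satisfied. Thus there is a `p`-adic
  unit `u ∈ (ℤ_p^ur)^×` for which (5.4) `𝓕_E(0) = u · 𝓛_E(0)` … The hypotheses on `φ` imply that
  `E(K)[p] = 0`, and so Theorem 5.1.1 applies with `P = P_K`, which combined with Theorem 5.1.3 and
  the relations (4.2) and (5.4) yields the equality
  (5.5) `ord_p(#Ш(E/K)) = 2 ord_p(c_E⁻¹ u_K⁻¹ · [E(K) : ℤ.P_K]) − Σ_{w ∈ S} ord_p(c_w(E/K))`."
* The data of (5.5) (§5.1.2, L2432–L2447): "fix a parametrization `π : X₀(N) → E` … Let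
  `x₁ = [ℂ/𝓞_K → ℂ/𝔑⁻¹] ∈ X₀(N)` be the Heegner point of conductor `1` on `X₀(N)`, which is defined
  over the Hilbert class field `H = K[1]` of `K`, and set `P_K = Σ_{σ ∈ Gal(H/K)} π(x₁)^σ ∈ E(K)` …
  let `c_E ∈ ℤ` be the associated *Manin constant*, so that `π^*(ω_E) = c_E · ω_f`";
  `u_K = #(𝓞_K^×/{±1})` (Thm. 5.1.2), and "Note that `u_K = 1`, since `D_K < -4`" (L2651);
  `S` = the set of places `w ∣ N` of `K` (§2; Thm. 5.1.1 prints `∏_{w ∣ N} c_w(E/K)_p`, "the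
  `p`-part of the Tamagawa number of `E/K_w`").

## Transcription

* `E` = a globally minimal `W/ℚ`; `p > 2` good, `E[p]` reducible, `φ|_{G_p} ≠ 1, ω` =
  `2 < p`, `Good W p`, `Red W p`, `¬ Anom W p` (the tree's PROVED dictionary
  `Rank1Residual.not_anom_iff_cgs_of_mem_primesAbove`; as in A47/A52/A138/A142 and `display57`);
  `ord_{s=1} L(E,s) = 1` = `W.analyticRank = 1`; (a)–(d) VERBATIM as in `display57_rankOne_twist`
  (`IsImaginaryQuadratic K`, `Odd (discr K)`, `discr K < -4`,
  `SatisfiesHeegnerHypothesis (W.conductorNorm ℤ) K`, `SatisfiesHeegnerHypothesis p K`,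
  `L(E^{(D_K)},1) ≠ 0`).
* `π`, `c_E`, `P_K`: a modular parametrisation datum `Dt : ModularParametrizationData W N` (its
  field `Dt.c ∈ ℤ` IS the Manin constant: "`c Λ_f ⊆ Λ_E`, the pull-back of the Néron differential
  is `c · 2πi f(τ) dτ`", `Literature/…/ModularCurve.lean`), a Heegner datum `H` of discriminant
  `D_K`, an embedding `ι : K → ℂ`, and `P : E(K)` with `ι(P) = heegnerPointComplex Dt H =
  Σ_{[Q]} φ(τ_Q) = Tr_{H_K/K} π(x₁) = P_K` (`Literature/…/HeegnerPoints.lean`; the same datum shape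
  as `IsHeegnerPoint`, `X11b.IndexIdentityAt`'s consumers and `X2.HeegnerIndexIdentity`).
* `#Ш(E/K)` = `(W.baseChange K).shaOrder` (`Nat.card`; finite here by Kolyvagin, invoked in the
  proof BEFORE (5.5) — kept as the explicit hypothesis `Finite (W.baseChange K).sha`, exactly as in
  `X2.HeegnerIndexIdentity` and in the `hid` binder of `X11b.bsdp_of_indexIdentityAt`; weaker than
  print, never stronger); `[E(K) : ℤ.P_K]` = `(AddSubgroup.zmultiples P).index`;
  `ord_p(c_E⁻¹ u_K⁻¹ · m) = ord_p(m) − ord_p(c_E)` (`u_K = 1` under (a); `c_E, m` non-zero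
  integers in print) with `ord_p(c_E) = padicValInt p Dt.c`;
  `Σ_{w ∈ S} ord_p(c_w(E/K)) = ord_p ∏_w c_w(E/K) = padicValNat p (W.baseChange K).tamagawaProduct`
  (the tree's Tamagawa product over ALL finite places of `K`; `c_w = 1` off `N`, where `E/K` has good
  reduction — the reading used by the cell for JSW (eq:shalowerK-1) / Castella (5.3) in
  `X11b/BDPRoute.lean` and `X11b/TamagawaQuadraticBaseChange.lean`).

## Contents

* `display55_sha_heegnerIndex` — the NAMED FACT (nothing asserted).
* `two_mul_index_eq_of_display55` — rearranged: `2·ord_p[E(K):ℤP] = ord_p#Ш(E/K) + ord_p∏_w c_w + 2·ord_p c_E`.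
* `sha_add_tamagawa_le_of_display55` — the Kolyvagin-direction bound, Manin-free.
* `indexIdentity_of_display55` — for `p ∤ c_E` and `ord_p ∏_w c_w(E/K) = 2·ord_p ∏_ℓ c_ℓ(E/ℚ)`
  (all-split `K`; a Summits theorem at `p ≥ 5`, `X11b.padicValNat_tamagawaProduct_baseChange_quadratic_eq_two_mul`):
  `2·ord_p ∏_ℓ c_ℓ(E/ℚ) + ord_p #Ш(E/K) = 2·ord_p [E(K):ℤ·P]` — LITERALLY the body of
  `X11b.IndexIdentityAt W p K P`; and `indexLowerBound_of_display55` (the body of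
  `X11b.IndexLowerBoundAt`, JSW's STEP L shape).

## References

* [CastellaGrossiLeeSkinner2022] Invent. Math. 227 (2022) 517–580 = arXiv:2008.02571v2 (final): proof of
  Thm. 5.3.1, displays (5.4)–(5.7); Thm. 4.2.2, Thm. 5.1.1, Thm. 5.1.2, Thm. 5.1.3, (4.2).
* [CastellaGrossiSkinner2025] Math. Ann. 393 (2025), Thm. D and its proof (§0.3, p. 5): "In the case
  `r = 1`, we argue as in [CGLS22]" — the same derivation without the parity bullet anywhere.
* [GrossZagier1986] V.(2.2); [GrossLMS1991] Conj. (2.2); [JetchevSkinnerWan2017] §7.4.1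
  (eq:shalowerK-1); [Castella2018] (5.3) — the currency `X11b.IndexIdentityAt` / `IndexLowerBoundAt`.
* HOME/CITED-FACTS.md A47 (CGS Thm. D), A52 (CGLS Thm. F), the (5.7) row; RESIDUAL-CASES.md §a.1 C6;
  deliverable HOME/b2b-bsdres-lit-cgls/CGLS-GV-TYPING.md §10 (session 3).
-/

set_option autoImplicit false

noncomputable section

open scoped Classical

open WeierstrassCurve Literature.NumberTheory.EllipticCurves
  Literature.NumberTheory.EllipticCurves.ModularForms Literature.NumberTheory.QuadraticFields
  Literature.NumberTheory.EllipticCurves.Rank1Residual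

namespace Literature.NumberTheory.EllipticCurves.CastellaGrossiLeeSkinner2022

/-- **Castella–Grossi–Lee–Skinner, Invent. Math. 227 (2022) = arXiv:2008.02571v2 (final), display (5.5)
(`eq:thmA-bis`) of the proof of Theorem 5.3.1 (§5.3) — the Heegner-index identity over `K`.**
Under the hypotheses in force there — "`E/ℚ` an elliptic curve, `p > 2` a prime of good ordinary
reduction for `E`, `E` admits a cyclic `p`-isogeny with kernel `C = 𝔽_p(φ)`, `φ|_{G_p} ≠ 1, ω`;
`ord_{s=1} L(E,s) = 1`; `K` an imaginary quadratic field of discriminant `D_K` such that (a)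
`D_K < -4` is odd, (b) every prime `ℓ` dividing `N` splits in `K`, (c) `p` splits in `K`, (d)
`L(E^K,1) ≠ 0`" (the parity bullet of Thm. 5.3.1 is NOT among them: it enters only after (5.7)),
with "a parametrization `π : X₀(N) → E`", "`c_E ∈ ℤ` the associated Manin constant,
`π^*(ω_E) = c_E · ω_f`", "`P_K = Σ_{σ ∈ Gal(H/K)} π(x₁)^σ ∈ E(K)`", `u_K = #(𝓞_K^×/{±1})` ("`u_K = 1`,
since `D_K < -4`") — the proof establishes, from Thm. 4.2.2 (the anticyclotomic Iwasawa–Greenberg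
statement for `𝔛_E`), Thm. 5.1.1 (anticyclotomic control), Thm. 5.1.3 (the BDP formula), (4.2) and
(5.4), after "`rank_ℤ E(K) = 1` and `#Ш(E/K) < ∞` by [Kolyvagin]":
"(5.5) `ord_p(#Ш(E/K)) = 2 ord_p(c_E⁻¹ u_K⁻¹ · [E(K) : ℤ.P_K]) − Σ_{w ∈ S} ord_p(c_w(E/K))`"
(`S` = the places `w ∣ N` of `K`; `c_w(E/K)_p` "the `p`-part of the Tamagawa number of `E/K_w`").
Transcribed for a globally minimal model `W`, `2 < p`, `Good W p`, `Red W p`, `¬ Anom W p`,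
`W.analyticRank = 1`, the field binders (a)–(d) VERBATIM as in `display57_rankOne_twist`, a modular
parametrisation datum `Dt` of level `N` (Manin constant `Dt.c`), a Heegner datum `H` of discriminant
`D_K`, an embedding `ι` and the point `P ∈ E(K)` with `ι(P) = heegnerPointComplex Dt H` (`= P_K`),
`#Ш(E/K) = (W.baseChange K).shaOrder` under the explicit hypothesis that `Ш(E/K)` is finite (as in
`X2.HeegnerIndexIdentity`), `[E(K):ℤ.P_K] = (zmultiples P).index`,
`ord_p(c_E⁻¹ u_K⁻¹ m) = ord_p m − ord_p c_E`, and `Σ_{w∈S} ord_p c_w(E/K) = ord_p` of the tree's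
Tamagawa product of `E/K` (`c_w = 1` off `N`). PUBLISHED. Named fact; nothing asserted.
[cite: CastellaGrossiLeeSkinner2022, proof of Thm. 5.3.1, display (5.5) (TeX `eq:thmA-bis`), with §5.1.2 (P_K, c_E, u_K) and Thm. 5.1.1]
[cite: CastellaGrossiSkinner2025, Thm. D and its proof (§0.3 p. 5) ("In the case r = 1, we argue as in [CGLS22]")] -/
def display55_sha_heegnerIndex : Prop :=
  ∀ (W : WeierstrassCurve ℚ) [W.IsElliptic] [W.IsGloballyMinimal] (p : ℕ) [Fact p.Prime],
    2 < p → Good W p → Red W p → ¬ Anom W p → W.analyticRank = 1 →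
    ∀ (K : Type) [Field K] [NumberField K], IsImaginaryQuadratic K →
      Odd (NumberField.discr K) → NumberField.discr K < -4 →
      SatisfiesHeegnerHypothesis (W.conductorNorm ℤ) K → SatisfiesHeegnerHypothesis p K →
      (W.quadraticTwist (NumberField.discr K : ℚ)).entireLFunction 1 ≠ 0 →
    ∀ (N : ℕ) [NeZero N] (Dt : ModularParametrizationData W N)
      (H : HeegnerDatum N (NumberField.discr K)) (ι : K →+* ℂ) (P : (W.baseChange K).toAffine.Point),
      WeierstrassCurve.Affine.Point.map ι.toRatAlgHom P = heegnerPointComplex Dt H →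
      Finite (W.baseChange K).sha →
      (padicValNat p (W.baseChange K).shaOrder : ℤ) =
        2 * ((padicValNat p (AddSubgroup.zmultiples P).index : ℤ) - (padicValInt p Dt.c : ℤ)) -
          (padicValNat p (W.baseChange K).tamagawaProduct : ℤ)

variable {W : WeierstrassCurve ℚ} [W.IsElliptic] [W.IsGloballyMinimal] {p : ℕ} [Fact p.Prime]

/-! ### Bookkeeping consumers (Manin constant kept) -/

/-- **(5.5) rearranged: `2·ord_p [E(K):ℤ.P_K] = ord_p #Ш(E/K) + Σ_w ord_p c_w(E/K) + 2·ord_p c_E`.**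
Pure arithmetic on the display at one datum. [cite: CastellaGrossiLeeSkinner2022, proof of Thm. 5.3.1, display (5.5)] -/
theorem two_mul_index_eq_of_display55 (h55 : display55_sha_heegnerIndex) (hp : 2 < p)
    (hgood : Good W p) (hred : Red W p) (hna : ¬ Anom W p) (hr : W.analyticRank = 1)
    (K : Type) [Field K] [NumberField K] (hK : IsImaginaryQuadratic K)
    (hodd : Odd (NumberField.discr K)) (hlt : NumberField.discr K < -4)
    (hHN : SatisfiesHeegnerHypothesis (W.conductorNorm ℤ) K) (hHp : SatisfiesHeegnerHypothesis p K)
    (hLK : (W.quadraticTwist (NumberField.discr K : ℚ)).entireLFunction 1 ≠ 0)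
    {N : ℕ} [NeZero N] (Dt : ModularParametrizationData W N)
    (H : HeegnerDatum N (NumberField.discr K)) (ι : K →+* ℂ) (P : (W.baseChange K).toAffine.Point)
    (hP : WeierstrassCurve.Affine.Point.map ι.toRatAlgHom P = heegnerPointComplex Dt H)
    (hfin : Finite (W.baseChange K).sha) :
    2 * padicValNat p (AddSubgroup.zmultiples P).index =
      padicValNat p (W.baseChange K).shaOrder + padicValNat p (W.baseChange K).tamagawaProduct +
        2 * padicValInt p Dt.c := by
  have h := h55 W p hp hgood hred hna hr K hK hodd hlt hHN hHp hLK N Dt H ι P hP hfin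
  omega

/-- **The Kolyvagin-direction half of (5.5), Manin-free:
`ord_p #Ш(E/K) + Σ_w ord_p c_w(E/K) ≤ 2·ord_p [E(K):ℤ.P_K]`** (since `ord_p c_E ≥ 0`).
[cite: CastellaGrossiLeeSkinner2022, proof of Thm. 5.3.1, display (5.5)] -/
theorem sha_add_tamagawa_le_of_display55 (h55 : display55_sha_heegnerIndex) (hp : 2 < p)
    (hgood : Good W p) (hred : Red W p) (hna : ¬ Anom W p) (hr : W.analyticRank = 1)
    (K : Type) [Field K] [NumberField K] (hK : IsImaginaryQuadratic K)
    (hodd : Odd (NumberField.discr K)) (hlt : NumberField.discr K < -4)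
    (hHN : SatisfiesHeegnerHypothesis (W.conductorNorm ℤ) K) (hHp : SatisfiesHeegnerHypothesis p K)
    (hLK : (W.quadraticTwist (NumberField.discr K : ℚ)).entireLFunction 1 ≠ 0)
    {N : ℕ} [NeZero N] (Dt : ModularParametrizationData W N)
    (H : HeegnerDatum N (NumberField.discr K)) (ι : K →+* ℂ) (P : (W.baseChange K).toAffine.Point)
    (hP : WeierstrassCurve.Affine.Point.map ι.toRatAlgHom P = heegnerPointComplex Dt H)
    (hfin : Finite (W.baseChange K).sha) :
    padicValNat p (W.baseChange K).shaOrder + padicValNat p (W.baseChange K).tamagawaProduct ≤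
      2 * padicValNat p (AddSubgroup.zmultiples P).index := by
  have h := two_mul_index_eq_of_display55 h55 hp hgood hred hna hr K hK hodd hlt hHN hHp hLK Dt H ι P
    hP hfin
  omega

/-! ### At a datum with `p ∤ c_E` and an all-split `K`: the body of `X11b.IndexIdentityAt` -/

/-- **(5.5) at a parametrisation with Manin constant prime to `p`, for `K` with every `ℓ ∣ N`
split: `2·ord_p ∏_ℓ c_ℓ(E/ℚ) + ord_p #Ш(E/K) = 2·ord_p [E(K) : ℤ·P]`** — LITERALLY the body of the
cell's predicate `X11b.IndexIdentityAt W p K P` (`Summits/…/X11b/BDPRoute.lean`; the `p`-part of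
Gross–Zagier V.(2.2) / Castella 2018 (5.3)), given the Tamagawa transport value
`ord_p ∏_w c_w(E/K) = 2·ord_p ∏_ℓ c_ℓ(E/ℚ)` (`htamK`; for `K` with every `ℓ ∣ N` split this is
`c_w(E/K) = c_ℓ(E/ℚ)` at both `w ∣ ℓ` — Jetchev–Skinner–Wan (eq:tamK) —, a Summits theorem at
`p ≥ 5`: `X11b.padicValNat_tamagawaProduct_baseChange_quadratic_eq_two_mul`) and `p ∤ c_E` (`hc`;
`ord_p c_E = 0`). At a GOOD non-anomalous Eisenstein `p` the identity is thus PRINT ((5.5)); at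
`p ∥ N` it is the TYPED input `X2.HeegnerIndexIdentity` of sub-cell X2c.
[cite: CastellaGrossiLeeSkinner2022, proof of Thm. 5.3.1, display (5.5)]
[cite: JetchevSkinnerWan2017, §7.3.1 (eq:tamK) and §7.4.1 (eq:shalowerK-1)]
[cite: Castella2018, (5.3) (p. 12)] -/
theorem indexIdentity_of_display55 (h55 : display55_sha_heegnerIndex) (hp : 2 < p)
    (hgood : Good W p) (hred : Red W p) (hna : ¬ Anom W p) (hr : W.analyticRank = 1)
    (K : Type) [Field K] [NumberField K] (hK : IsImaginaryQuadratic K)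
    (hodd : Odd (NumberField.discr K)) (hlt : NumberField.discr K < -4)
    (hHN : SatisfiesHeegnerHypothesis (W.conductorNorm ℤ) K) (hHp : SatisfiesHeegnerHypothesis p K)
    (hLK : (W.quadraticTwist (NumberField.discr K : ℚ)).entireLFunction 1 ≠ 0)
    {N : ℕ} [NeZero N] (Dt : ModularParametrizationData W N)
    (H : HeegnerDatum N (NumberField.discr K)) (ι : K →+* ℂ) (P : (W.baseChange K).toAffine.Point)
    (hP : WeierstrassCurve.Affine.Point.map ι.toRatAlgHom P = heegnerPointComplex Dt H)
    (hc : ¬ (p : ℤ) ∣ Dt.c)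
    (htamK : padicValNat p (W.baseChange K).tamagawaProduct = 2 * padicValNat p W.tamagawaProduct)
    (hfin : Finite (W.baseChange K).sha) :
    2 * padicValNat p W.tamagawaProduct + padicValNat p (W.baseChange K).shaOrder =
      2 * padicValNat p (AddSubgroup.zmultiples P).index := by
  have h := two_mul_index_eq_of_display55 h55 hp hgood hred hna hr K hK hodd hlt hHN hHp hLK Dt H ι P
    hP hfin
  have hc0 : padicValInt p Dt.c = 0 := padicValInt.eq_zero_of_not_dvd hc
  omega

/-- **(5.5) ⟹ the STEP-L shape `2·ord_p [E(K):ℤ·P] ≤ ord_p #Ш(E/K) + 2·ord_p ∏_ℓ c_ℓ(E/ℚ)`**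
(the body of `X11b.IndexLowerBoundAt W p K P`, Jetchev–Skinner–Wan (eq:shalowerK-1) /
Castella 2018 (1.1)), at a datum with `p ∤ c_E` and the Tamagawa transport value.
[cite: CastellaGrossiLeeSkinner2022, proof of Thm. 5.3.1, display (5.5)]
[cite: JetchevSkinnerWan2017, §7.4.1 (eq:shalowerK-1), p. 30 of arXiv:1512.06894] -/
theorem indexLowerBound_of_display55 (h55 : display55_sha_heegnerIndex) (hp : 2 < p)
    (hgood : Good W p) (hred : Red W p) (hna : ¬ Anom W p) (hr : W.analyticRank = 1)
    (K : Type) [Field K] [NumberField K] (hK : IsImaginaryQuadratic K)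
    (hodd : Odd (NumberField.discr K)) (hlt : NumberField.discr K < -4)
    (hHN : SatisfiesHeegnerHypothesis (W.conductorNorm ℤ) K) (hHp : SatisfiesHeegnerHypothesis p K)
    (hLK : (W.quadraticTwist (NumberField.discr K : ℚ)).entireLFunction 1 ≠ 0)
    {N : ℕ} [NeZero N] (Dt : ModularParametrizationData W N)
    (H : HeegnerDatum N (NumberField.discr K)) (ι : K →+* ℂ) (P : (W.baseChange K).toAffine.Point)
    (hP : WeierstrassCurve.Affine.Point.map ι.toRatAlgHom P = heegnerPointComplex Dt H)
    (hc : ¬ (p : ℤ) ∣ Dt.c)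
    (htamK : padicValNat p (W.baseChange K).tamagawaProduct = 2 * padicValNat p W.tamagawaProduct)
    (hfin : Finite (W.baseChange K).sha) :
    2 * padicValNat p (AddSubgroup.zmultiples P).index ≤
      padicValNat p (W.baseChange K).shaOrder + 2 * padicValNat p W.tamagawaProduct := by
  have h := indexIdentity_of_display55 h55 hp hgood hred hna hr K hK hodd hlt hHN hHp hLK Dt H ι P hP
    hc htamK hfin
  omega

end Literature.NumberTheory.EllipticCurves.CastellaGrossiLeeSkinner2022

end
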